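import Summits.FinalStateConjecture.FinalStateConjecture.Theorems.EIHFluxBalanceInertialRecessionHoleTransportEstimate
import Summits.FinalStateConjecture.FinalStateConjecture.Theorems.EIHFluxBalanceInertialRecessionKinematics
import Summits.FinalStateConjecture.FinalStateConjecture.Theorems.EIHFluxBalanceInertialRecessionOtherHoles
import Literature.Geometry.Lorentzian.MultiCentreRadiationZone
import Summits.FinalStateConjecture.FinalStateConjecture.Theorems.EIHFluxBalanceInertialRecessionFlatChartSchwarzschild

/-!
# Route EIHFluxBalance — `InertialRecession`: near-zone convergence of the `a = 0` hole charts

Helper file for the crux `stmt-FinalStateConjecture-10166`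
(`Summit.FinalStateConjecture.FinalStateConjecture.Theses.EIHFluxBalance.InertialRecession`).
The hole chart of hole `i` is `ψ = Φ ∘ A` on the boosted Schwarzschild exterior of the final motion
`(boost V, 0)`, `A` the Fermi-type re-charting map (honest near the near zone). Proved here: the
pointwise `C²` bound `norm_iteratedFDeriv_deviation_holeChart_le` (re-charting identity of `…Pullback`,
transport defect of `…HoleTransportEstimate`) and, for every fixed `R`, the clause
`tendsto_truncDeviationCk` of `FinalStateDecomposition`: `tendsto_truncDeviationCk_holeChart'`
(registered form unprimed) — the `C²` deviation of `ψ^* g` from boosted Schwarzschild on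
`{t* = τ, r ≤ R}` tends to `0`, from the crux's lab-slab convergence and the kinematic output of the
line's dynamics.
-/

noncomputable section

open scoped Topology ContDiff InnerProductSpace BigOperators Manifold ENNReal
open Filter Set Metric Function TopologicalSpace Literature.Geometry.Lorentzian

namespace Summit.FinalStateConjecture.FinalStateConjecture.Theorems

section PointBound

variable (𝓢 : Spacetime 4) {N : ℕ} (i : Fin N) (M : Fin N → ℝ) (ξ v : Fin N → ℝ → E3)
  (hv1 : ∀ j t, ‖v j t‖ < 1) {V : E3} (hV : ‖V‖ < 1) {Ah : E4 → E4}
  (hAh : ∀ y : E4, Ah y = E4.ofTimeSpace (y 0) (ξ i (y 0) +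
    (ContinuousLinearMap.id ℝ E3 - (Lorentz.gamma (v i (y 0)) / (Lorentz.gamma (v i (y 0)) + 1)) •
      (innerSL ℝ (v i (y 0))).smulRight (v i (y 0)))
      (E4.spatial ((Lorentz.boost V hV : E4 ≃L[ℝ] E4).symm y))))
  {H : Fin N → E4 → E4 →L[ℝ] E4 →L[ℝ] ℝ}
  (hH : ∀ j z, H j z = boostedKerrBilin (Lorentz.boost (v j (z 0)) (hv1 j (z 0)))
    (E4.ofTimeSpace (z 0) (ξ j (z 0))) (M j) 0 z - Minkowski.bilin)
  {Bb : E4 → E4 →L[ℝ] E4 →L[ℝ] ℝ} (hBb : ∀ z, Bb z = Minkowski.bilin + ∑ j, H j z)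
  (hξ : ∀ j, ContDiff ℝ ∞ (ξ j)) (hv : ∀ j, ContDiff ℝ ∞ (v j))
  (U : Opens E4) (Φ : U → 𝓢.carrier) (hΦ : ContMDiff 𝓘(ℝ, E4) (𝓡 4) ∞ Φ)
  {A : E4 → E4} (hAc : ContDiff ℝ ∞ A)
  (hAU : ∀ y ∈ boostedKerrExterior (Lorentz.boost V hV) 0 (M i) 0, A y ∈ U)
  {ψ : boostedKerrExterior (Lorentz.boost V hV) 0 (M i) 0 → 𝓢.carrier}
  (hψ : ∀ y, ψ y = Φ ⟨A y.1, hAU y.1 y.2⟩)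

include hv1 hAh hH hBb hξ hv hΦ hAc hψ in
-- long chain of `C²` bookkeeping
set_option maxHeartbeats 400000 in
/-- **Pointwise `C²` bound of the hole chart's deviation.** At a model point `x` of the boosted
exterior near which the re-charting map `A` is the honest placement, with rest offset
`r₀ ≤ ‖y̲‖ ≤ R`, painted kinematics `δ₀`-close to the frozen data at lab time `x⁰`
(`δ = (4 + R + 3‖Λ∞⁻¹‖) δ₀ ≤ 1`), the other painted summands `C²`-small (`≤ η₂`) with positive
painted radius at `A x`, and the lab deviation `Φ^*g − g_B` `C²`-small (`≤ η₁`) at `A x ∈ U`: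
`‖Dᵐ ((Φ ∘ A)^* g − g_{K∞})(x)‖ ≤ 2⁹ η₁ + 16 C_K (2‖Λ∞⁻¹‖ + 5 + C_a)(4 + C_a) δ + N 2¹⁰ η₂` for
`m ≤ 2`. [folklore] -/
theorem norm_iteratedFDeriv_deviation_holeChart_le {x : E4}
    (hxΩ : x ∈ boostedKerrExterior (Lorentz.boost V hV) 0 (M i) 0) (hAeq : A =ᶠ[𝓝 x] Ah)
    {r₀ R δ₀ Ca CK η₁ η₂ : ℝ} (hr₀ : 0 < r₀) (hCa : 0 ≤ Ca) (hη₁ : 0 ≤ η₁) (hη₂ : 0 ≤ η₂)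
    (hCK : ∀ y : E4, r₀ ≤ E4.spatialNorm ((((Lorentz.boost V hV : E4 ≃L[ℝ] E4).symm : E4 →L[ℝ] E4)) y) →
      ∀ l ≤ 2, ‖iteratedFDeriv ℝ l (fun z ↦ Kerr.bilin (M i) 0
        ((((Lorentz.boost V hV : E4 ≃L[ℝ] E4).symm : E4 →L[ℝ] E4)) z)) y‖ ≤ CK)
    (hr : r₀ ≤ ‖E4.spatial ((Lorentz.boost V hV : E4 ≃L[ℝ] E4).symm x)‖)
    (hR : ‖E4.spatial ((Lorentz.boost V hV : E4 ≃L[ℝ] E4).symm x)‖ ≤ R) (hδ0 : 0 ≤ δ₀)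
    (hδ1 : (4 + R + 3 * ‖(((Lorentz.boost V hV : E4 ≃L[ℝ] E4).symm : E4 →L[ℝ] E4))‖) * δ₀ ≤ 1)
    (hk1 : ‖deriv (ξ i) (x 0) - V‖ ≤ δ₀)
    (hk2 : ∀ l, 2 ≤ l → l ≤ 3 → ‖iteratedDeriv l (ξ i) (x 0)‖ ≤ δ₀)
    (hk3 : ∀ l, 1 ≤ l → l ≤ 3 → ‖iteratedDeriv l (fun s ↦ ContinuousLinearMap.id ℝ E3 -
      (Lorentz.gamma (v i s) / (Lorentz.gamma (v i s) + 1)) • (innerSL ℝ (v i s)).smulRight (v i s))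
        (x 0)‖ ≤ δ₀)
    (hk4 : ‖(ContinuousLinearMap.id ℝ E3 - (Lorentz.gamma (v i (x 0)) / (Lorentz.gamma (v i (x 0)) + 1)) •
        (innerSL ℝ (v i (x 0))).smulRight (v i (x 0))) - (ContinuousLinearMap.id ℝ E3 -
          (Lorentz.gamma V / (Lorentz.gamma V + 1)) • (innerSL ℝ V).smulRight V)‖ ≤ δ₀)
    (hk5 : ‖Lorentz.boostCLM (-v i (x 0)) - Lorentz.boostCLM (-V)‖ ≤ δ₀)
    (hk6 : ∀ l, 1 ≤ l → l ≤ 2 → ‖iteratedDeriv l (fun s ↦ Lorentz.boostCLM (-v i s)) (x 0)‖ ≤ δ₀)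
    (hk7 : ‖Lorentz.boostCLM (-v i (x 0))‖ ≤ Ca)
    (hoth : ∀ j ≠ i, 0 < E4.spatialNorm (Lorentz.boostCLM (-v j (Ah x 0))
        (Ah x - E4.ofTimeSpace (Ah x 0) (ξ j (Ah x 0)))) ∧
      ∀ l ≤ 2, ‖iteratedFDeriv ℝ l (H j) (Ah x)‖ ≤ η₂)
    (hAxU : Ah x ∈ U)
    (hdevb : ∀ l ≤ 2, ‖iteratedFDeriv ℝ l
      (𝓢.deviationExtend ⟨U, Bb, fun z ↦ z 0, E4.spatialNorm⟩ Φ) (Ah x)‖ ≤ η₁) :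
    ∀ m ≤ 2, ‖iteratedFDeriv ℝ m
        (𝓢.deviationExtend (boostedKerrBackground (Lorentz.boost V hV) 0 (M i) 0) ψ) x‖ ≤
      2 ^ 9 * η₁ +
      16 * CK * (2 * ‖(((Lorentz.boost V hV : E4 ≃L[ℝ] E4).symm : E4 →L[ℝ] E4))‖ + 5 + Ca) *
        (4 + Ca) * ((4 + R + 3 * ‖(((Lorentz.boost V hV : E4 ≃L[ℝ] E4).symm : E4 →L[ℝ] E4))‖) * δ₀) +
      N * 2 ^ 10 * η₂ := by
  set Bf : ModelBackground := ⟨U, Bb, fun z ↦ z 0, E4.spatialNorm⟩ with hBf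
  set K : ModelBackground := boostedKerrBackground (Lorentz.boost V hV) 0 (M i) 0 with hK
  have hAhc : ContDiff ℝ ∞ Ah := contDiff_honest i ξ v hv1 hV hAh hξ hv
  have hA0 : Ah x 0 = x 0 := by rw [hAh x, E4.ofTimeSpace_apply_zero]
  have hr' : 0 < ‖E4.spatial ((Lorentz.boost V hV : E4 ≃L[ℝ] E4).symm x)‖ := hr₀.trans_le hr
  have hR0 : 0 ≤ R := (norm_nonneg _).trans hR
  -- the re-charting identity near `x`, with `A` replaced by the honest placement
  have hev1 := deviationExtend_comp_smooth_eventuallyEq (𝓢 := 𝓢) Bf K (f := A) (Φ := Φ) (Ψ := ψ)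
    hAc hAU hψ hΦ hxΩ
  have hfd : fderiv ℝ A =ᶠ[𝓝 x] fderiv ℝ Ah := hAeq.fderiv
  have hev : 𝓢.deviationExtend K ψ =ᶠ[𝓝 x]
      ((fun z ↦ (𝓢.deviationExtend Bf Φ (Ah z)).bilinearComp (fderiv ℝ Ah z) (fderiv ℝ Ah z)) +
        fun z ↦ (Bb (Ah z)).bilinearComp (fderiv ℝ Ah z) (fderiv ℝ Ah z) -
          boostedKerrBilin (Lorentz.boost V hV) 0 (M i) 0 z) := by
    filter_upwards [hev1, hAeq, hfd] with z h1 h2 h3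
    rw [h1, Pi.add_apply, h2, h3]
    rfl
  -- smoothness of the two pieces at `x`
  have hposj : ∀ j, 0 < E4.spatialNorm (Lorentz.boostCLM (-v j (Ah x 0))
      (Ah x - E4.ofTimeSpace (Ah x 0) (ξ j (Ah x 0)))) := by
    intro j
    by_cases hj : j = i
    · subst hj
      rw [spatialNorm_own_honest' j ξ v hv1 hV hAh x]
      exact hr'
    · exact (hoth j hj).1
  -- the open set on which the lab deviation is smooth
  set W : Set E4 := {z | z ∈ (U : Set E4) ∧ ∀ j, 0 < E4.spatialNorm (Lorentz.boostCLM (-v j (z 0))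
      (z - E4.ofTimeSpace (z 0) (ξ j (z 0))))} with hW
  have hcont : ∀ j, Continuous fun z : E4 ↦ E4.spatialNorm (Lorentz.boostCLM (-v j (z 0))
      (z - E4.ofTimeSpace (z 0) (ξ j (z 0)))) := by
    intro j
    have h0 : Continuous fun z : E4 ↦ z 0 := (EuclideanSpace.proj (0 : Fin 4) : E4 →L[ℝ] ℝ).continuous
    have hc : Continuous fun z : E4 ↦ Lorentz.boostCLM (-v j (z 0)) :=
      (contDiff_boostCLM_neg_comp (hv j) (hv1 j)).continuous.comp h0
    have hcc : Continuous fun s : ℝ ↦ E4.ofTimeSpace s (ξ j s) := by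
      have hsplit : (fun s ↦ E4.ofTimeSpace s (ξ j s)) =
          fun s : ℝ ↦ s • E4.basisVector 0 + E4.spaceEmbed (ξ j s) :=
        funext fun s ↦ E4.ofTimeSpace_eq_smul_add' s (ξ j s)
      rw [hsplit]
      exact (continuous_id.smul continuous_const).add
        (E4.spaceEmbed.continuous.comp (hξ j).continuous)
    have h1 := hc.clm_apply (continuous_id.sub (hcc.comp h0))
    unfold E4.spatialNorm
    fun_prop
  have hWo : IsOpen W := by
    have h2 : IsOpen {z : E4 | ∀ j, 0 < E4.spatialNorm (Lorentz.boostCLM (-v j (z 0))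
        (z - E4.ofTimeSpace (z 0) (ξ j (z 0))))} := by
      rw [Set.setOf_forall]
      exact isOpen_iInter_of_finite fun j ↦ isOpen_lt continuous_const (hcont j)
    exact U.isOpen.inter h2
  have hxW : Ah x ∈ W := ⟨hAxU, hposj⟩
  have hHc : ∀ z ∈ W, ∀ j, ContDiffAt ℝ ∞ (H j) z := by
    intro z hz j
    have hΛjc : ContDiff ℝ ∞ (fun s ↦ (((Lorentz.boost (v j s) (hv1 j s) : E4 ≃L[ℝ] E4).symm :
        E4 →L[ℝ] E4))) :=
      contDiff_iff_contDiffAt.mpr fun s ↦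
        (contDiff_boostCLM_neg_comp (hv j) (hv1 j)).contDiffAt.congr_of_eventuallyEq
          (Filter.Eventually.of_forall fun s ↦ coe_boost_symm' (hv1 j s))
    have hrad : 0 < Kerr.radius 0 ((((Lorentz.boost (v j (z 0)) (hv1 j (z 0)) : E4 ≃L[ℝ] E4).symm :
        E4 →L[ℝ] E4)) (z - E4.ofTimeSpace (z 0) (ξ j (z 0)))) := by
      rw [Kerr.radius_zero_left, coe_boost_symm' (hv1 j (z 0))]
      exact hz.2 j
    exact (contDiffAt_ansatzSummand (M := M j) (a := 0) hΛjc (hξ j) hrad).congr_of_eventuallyEq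
      (Filter.Eventually.of_forall (hH j))
  have hFW : ContDiffOn ℝ ∞ (𝓢.deviationExtend Bf Φ) W := by
    intro z hz
    have hb : ContDiffAt ℝ ∞ Bf.bilin z := by
      have : ContDiffAt ℝ ∞ (fun z ↦ Minkowski.bilin + ∑ j, H j z) z :=
        contDiffAt_const.add (ContDiffAt.sum fun j _ ↦ hHc z hz j)
      exact this.congr_of_eventuallyEq (Filter.Eventually.of_forall hBb)
    exact (Spacetime.contDiffAt_deviationExtend_model 𝓢 Bf hΦ ⟨z, hz.1⟩ hb).contDiffWithinAt
  -- kinematic bounds on the honest placement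
  obtain ⟨-, -, hD2⟩ := honest_kinematic_bounds i ξ v hv1 hV hAh hξ hv hR hδ0 hk1 hk2 hk3 hk4
  have hD2' := hD2 hδ1
  -- first piece: the transported lab deviation
  have hG1b : ∀ m ≤ 2, ‖iteratedFDeriv ℝ m (fun z ↦ (𝓢.deviationExtend Bf Φ (Ah z)).bilinearComp
      (fderiv ℝ Ah z) (fderiv ℝ Ah z)) x‖ ≤ 2 ^ 9 * η₁ := by
    intro m hm
    have h := norm_iteratedFDeriv_bilinearComp_fderiv_le' hWo hFW hAhc hxW m
      (fun l hl ↦ hdevb l (hl.trans hm)) (fun l hl1 hl2 ↦ hD2' l hl1 (by omega)) (by norm_num)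
    refine h.trans ?_
    have h1 : (4 : ℝ) ^ m * m.factorial * 2 ^ (m + 2) ≤ 2 ^ 9 := by
      interval_cases m <;> norm_num [Nat.factorial]
    nlinarith
  have hG1c : ∀ m : ℕ, ContDiffAt ℝ m (fun z ↦ (𝓢.deviationExtend Bf Φ (Ah z)).bilinearComp
      (fderiv ℝ Ah z) (fderiv ℝ Ah z)) x := by
    intro m
    have hF : ContDiffAt ℝ ∞ (𝓢.deviationExtend Bf Φ) (Ah x) := (hFW _ hxW).contDiffAt (hWo.mem_nhds hxW)
    have hFA := hF.comp x hAhc.contDiffAt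
    have hD : ContDiffAt ℝ ∞ (fderiv ℝ Ah) x := (hAhc.fderiv_right (by simp)).contDiffAt
    exact ((contDiffWithinAt_bilinearComp_self (s := univ) hFA.contDiffWithinAt
      hD.contDiffWithinAt).contDiffAt univ_mem).of_le (by exact_mod_cast le_top)
  have hG2b := norm_iteratedFDeriv_transportDefect_le' i M ξ v hv1 hV hAh hH hBb hξ hv hr₀ hCa hη₂
    hCK hr hR hR0 hδ0 hδ1 hk1 hk2 hk3 hk4 hk5 hk6 hk7 hoth
  have hG2c : ∀ m : ℕ, ContDiffAt ℝ m (fun z ↦ (Bb (Ah z)).bilinearComp (fderiv ℝ Ah z) (fderiv ℝ Ah z) -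
      boostedKerrBilin (Lorentz.boost V hV) 0 (M i) 0 z) x := fun m ↦
    (contDiffAt_transportDefect i M ξ v hv1 hV hAh hH hBb hξ hv hr'
      (fun j hj ↦ (hoth j hj).1)).of_le (by exact_mod_cast le_top)
  intro m hm
  rw [(hev.iteratedFDeriv ℝ m).eq_of_nhds, iteratedFDeriv_add_apply (hG1c m) (hG2c m)]
  refine (norm_add_le _ _).trans ?_
  have e1 := hG1b m hm
  have e2 := hG2b m hm
  linarith

include hv1 hAh hH hBb hξ hv hΦ hAc hψ in
-- long chain of `C²` bookkeeping and filters
set_option maxHeartbeats 400000 in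
/-- **Near-zone convergence of the `a = 0` hole charts (fixed radius).** Under the crux's lab-slab
`C²` convergence to the modulated multi-Schwarzschild ansatz (general orthochronous frames `Λⱼ` with
painted lab velocities `vⱼ`, `‖vⱼ‖ ≤ κ₀ < 1`), eventual bounds on two derivatives of all painted
velocities and centres, recession of the other holes from hole `i`, and the kinematic limits of
hole `i` (`vᵢ → V`, `ξᵢ' → V`, `vᵢ⁽ˡ⁾ → 0` for `l ≤ 3`, `ξᵢ⁽ˡ⁾ → 0` for `l = 2, 3`): if the re-charting
map `A` (smooth, mapping the boosted exterior into `U`) agrees with the honest placement on the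
honest zone `{x⁰ ≥ T₁ + 1, ‖y̲‖ ≤ ρ(x⁰)/2}` of a continuous `ρ → ∞`, then for every `R` the `C²`
deviation of `(Φ ∘ A)^* g` from boosted Schwarzschild `(boost V, 0, Mᵢ, 0)` on the truncated slabs
`{t* = τ, r ≤ R}` tends to `0` as `τ → ∞` — the clause `tendsto_truncDeviationCk` of the sought
`FinalStateDecomposition` for hole `i`. [folklore] -/
theorem tendsto_truncDeviationCk_holeChart' (Λ : Fin N → ℝ → lorentzGroup)
    (hfut : ∀ j t, 0 < (((Λ j t : E4 ≃L[ℝ] E4) (E4.basisVector 0)) 0))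
    (hvΛ : ∀ j t, E4.spatial ((Λ j t : E4 ≃L[ℝ] E4) (E4.basisVector 0)) =
      (((Λ j t : E4 ≃L[ℝ] E4) (E4.basisVector 0)) 0) • v j t)
    (hdev : Tendsto (fun t ↦ 𝓢.deviationCk ⟨U, fun x ↦ Minkowski.bilin +
      ∑ j, (boostedKerrBilin (Λ j (x 0)) (E4.ofTimeSpace (x 0) (ξ j (x 0))) (M j) 0 x -
        Minkowski.bilin), fun x ↦ x 0, E4.spatialNorm⟩ Φ 2 t) atTop (𝓝 0))
    {κ₀ : ℝ} (hκ₀ : κ₀ < 1) (hvs : ∀ j t, ‖v j t‖ ≤ κ₀) {Γ T₀ : ℝ}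
    (hvb : ∀ j t, T₀ ≤ t → ∀ l, 1 ≤ l → l ≤ 2 → ‖iteratedDeriv l (v j) t‖ ≤ Γ)
    (hξb : ∀ j t, T₀ ≤ t → ∀ l, 1 ≤ l → l ≤ 2 → ‖iteratedDeriv l (ξ j) t‖ ≤ Γ)
    (hsep : ∀ j ≠ i, Tendsto (fun t ↦ ‖ξ i t - ξ j t‖) atTop atTop) (hMi : 0 < M i)
    (hvV : Tendsto (v i) atTop (𝓝 V)) (hξV : Tendsto (deriv (ξ i)) atTop (𝓝 V))
    (hξ0 : ∀ l, 2 ≤ l → l ≤ 3 → Tendsto (fun t ↦ iteratedDeriv l (ξ i) t) atTop (𝓝 0))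
    (hv0 : ∀ l, 1 ≤ l → l ≤ 3 → Tendsto (fun t ↦ iteratedDeriv l (v i) t) atTop (𝓝 0))
    {ρ : ℝ → ℝ} (hρ : Tendsto ρ atTop atTop) (hρc : Continuous ρ) {T₁ : ℝ}
    (hAhon : ∀ x : E4, T₁ + 1 ≤ x 0 →
      ‖E4.spatial ((Lorentz.boost V hV : E4 ≃L[ℝ] E4).symm x)‖ ≤ ρ (x 0) / 2 → A x = Ah x)
    (R : ℝ) :
    Tendsto (fun τ ↦ 𝓢.truncDeviationCk (boostedKerrBackground (Lorentz.boost V hV) 0 (M i) 0) ψ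
      2 R τ) atTop (𝓝 0) := by
  set Λe : E4 ≃L[ℝ] E4 := (Lorentz.boost V hV : E4 ≃L[ℝ] E4) with hΛe
  set Λi : E4 →L[ℝ] E4 := ((Λe.symm : E4 →L[ℝ] E4)) with hΛi
  set Bf : ModelBackground := ⟨U, Bb, fun z ↦ z 0, E4.spatialNorm⟩ with hBf
  set K : ModelBackground := boostedKerrBackground (Lorentz.boost V hV) 0 (M i) 0 with hK
  -- the painted frames are pure boosts: the two reference fields agree
  have hsum : (fun x : E4 ↦ Minkowski.bilin +
      ∑ j, (boostedKerrBilin (Λ j (x 0)) (E4.ofTimeSpace (x 0) (ξ j (x 0))) (M j) 0 x -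
        Minkowski.bilin)) = Bb := by
    funext x
    rw [hBb x]
    congr 1
    refine Finset.sum_congr rfl fun j _ ↦ ?_
    rw [hH, boostedKerrBilin_eq_boost_of_velocity (Λ j (x 0)) (hfut j (x 0)) (hvΛ j (x 0))
      (hv1 j (x 0))]
  rw [hsum] at hdev
  have hrp : 0 < Kerr.rPlus (M i) 0 := by
    have h1 : 0 ≤ √(M i ^ 2 - 0 ^ 2) := Real.sqrt_nonneg _
    show 0 < M i + √(M i ^ 2 - 0 ^ 2)
    linarith
  obtain ⟨Ca, hCa0, hkin⟩ := eventually_kinematics_small' (ξ := ξ i) hκ₀ (hvs i) (hv i) hvV hξV hξ0 hv0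
  obtain ⟨CK, hCK0, hCK⟩ := norm_iteratedFDeriv_kerrComp_le (M i) hrp 2
  set CKe : ℝ := CK * max 1 ‖Λi‖ ^ 2 with hCKe
  have hCKe : ∀ y : E4, Kerr.rPlus (M i) 0 ≤ E4.spatialNorm (Λi y) → ∀ l ≤ 2,
      ‖iteratedFDeriv ℝ l (fun z ↦ Kerr.bilin (M i) 0 (Λi z)) y‖ ≤ CKe := fun y hy l hl ↦ hCK Λi y hy l hl
  set Rp : ℝ := max R 0 with hRp
  have hRp0 : 0 ≤ Rp := le_max_right _ _
  set Cδ : ℝ := 16 * CKe * (2 * ‖Λi‖ + 5 + Ca) * (4 + Ca) * (4 + Rp + 3 * ‖Λi‖) with hCδ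
  have hCδ0 : 0 ≤ Cδ := by positivity
  refine ENNReal.tendsto_nhds_zero.2 fun ε hε ↦ ?_
  obtain ⟨ε', hε'0, hε'⟩ : ∃ ε' : ℝ, 0 < ε' ∧ ENNReal.ofReal ε' ≤ ε := by
    rcases eq_or_ne ε ⊤ with h | h
    · exact ⟨1, one_pos, h ▸ le_top⟩
    · exact ⟨ε.toReal, ENNReal.toReal_pos hε.ne' h, (ENNReal.ofReal_toReal h).le⟩
  set η₁ : ℝ := ε' / (3 * 2 ^ 9) with hη₁
  set η₂ : ℝ := ε' / (3 * (N * 2 ^ 10 + 1)) with hη₂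
  set δ₀ : ℝ := min (1 / (4 + Rp + 3 * ‖Λi‖)) (ε' / (3 * (Cδ + 1))) with hδ₀
  have hη₁0 : 0 < η₁ := by positivity
  have hη₂0 : 0 < η₂ := by positivity
  have hδ₀0 : 0 < δ₀ := lt_min (by positivity) (by positivity)
  have hδ1 : (4 + Rp + 3 * ‖Λi‖) * δ₀ ≤ 1 := by
    have h1 : δ₀ ≤ 1 / (4 + Rp + 3 * ‖Λi‖) := min_le_left _ _
    have h2 : 0 < 4 + Rp + 3 * ‖Λi‖ := by positivity
    calc (4 + Rp + 3 * ‖Λi‖) * δ₀ ≤ (4 + Rp + 3 * ‖Λi‖) * (1 / (4 + Rp + 3 * ‖Λi‖)) :=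
          mul_le_mul_of_nonneg_left h1 h2.le
      _ = 1 := by field_simp
  have hsum3 : 2 ^ 9 * η₁ + Cδ * δ₀ + N * 2 ^ 10 * η₂ ≤ ε' := by
    have e1 : (2 : ℝ) ^ 9 * η₁ = ε' / 3 := by rw [hη₁]; ring
    have e2 : Cδ * δ₀ ≤ ε' / 3 := by
      have h1 : δ₀ ≤ ε' / (3 * (Cδ + 1)) := min_le_right _ _
      have h2 : Cδ * (ε' / (3 * (Cδ + 1))) = (ε' / 3) * (Cδ / (Cδ + 1)) := by
        field_simp
      have h3 : Cδ / (Cδ + 1) ≤ 1 := (div_le_one (by positivity)).2 (by linarith)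
      calc Cδ * δ₀ ≤ Cδ * (ε' / (3 * (Cδ + 1))) := mul_le_mul_of_nonneg_left h1 hCδ0
        _ = (ε' / 3) * (Cδ / (Cδ + 1)) := h2
        _ ≤ (ε' / 3) * 1 := mul_le_mul_of_nonneg_left h3 (by positivity)
        _ = ε' / 3 := mul_one _
    have e3 : (N : ℝ) * 2 ^ 10 * η₂ ≤ ε' / 3 := by
      have hN : (0 : ℝ) ≤ N := Nat.cast_nonneg N
      have h2 : (N : ℝ) * 2 ^ 10 * (ε' / (3 * (N * 2 ^ 10 + 1))) =
          (ε' / 3) * (N * 2 ^ 10 / (N * 2 ^ 10 + 1)) := by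
        field_simp
      have h3 : (N : ℝ) * 2 ^ 10 / (N * 2 ^ 10 + 1) ≤ 1 := (div_le_one (by positivity)).2 (by linarith)
      rw [hη₂, h2]
      calc (ε' / 3) * (N * 2 ^ 10 / (N * 2 ^ 10 + 1)) ≤ (ε' / 3) * 1 :=
            mul_le_mul_of_nonneg_left h3 (by positivity)
        _ = ε' / 3 := mul_one _
    linarith
  -- eventual facts in the lab time
  have E1 := hkin δ₀ hδ₀0
  have E2 := eventually_otherHoles_small' i M ξ v hκ₀ hvs hv1 hv hξ hvb hξb hsep hH Rp hη₂0
  have E3 : ∀ᶠ w in atTop, 𝓢.deviationCk Bf Φ 2 w ≤ ENNReal.ofReal η₁ :=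
    ENNReal.tendsto_nhds_zero.1 hdev _ (ENNReal.ofReal_pos.2 hη₁0)
  have E4' : ∀ᶠ w in atTop, T₁ + 1 < w := eventually_gt_atTop _
  have E5 : ∀ᶠ w in atTop, 2 * Rp + 2 < ρ w := hρ.eventually (eventually_gt_atTop _)
  obtain ⟨W₀, hW₀⟩ := eventually_atTop.1 (E1.and (E2.and (E3.and (E4'.and E5))))
  refine eventually_atTop.2 ⟨max W₀ 0 + Rp + 1, fun τ hτ ↦ ?_⟩
  refine le_trans ?_ hε'
  refine iSup₂_le fun m hm ↦ iSup₂_le fun z hz ↦ ?_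
  obtain ⟨xs, ⟨hxt, hxr⟩, rfl⟩ := hz
  set x : E4 := xs.1 with hx
  have hxΩ : x ∈ boostedKerrExterior (Lorentz.boost V hV) 0 (M i) 0 := xs.2
  set y : E4 := Λe.symm x with hy
  have hPI : poincareInv (Lorentz.boost V hV) 0 x = y := by rw [poincareInv_zero]
  have hy0 : y 0 = τ := by
    have : K.time x = τ := hxt
    simpa [hK, boostedKerrBackground, hPI] using this
  have hyr : Kerr.radius 0 y = ‖E4.spatial y‖ := Kerr.radius_zero_left y
  have hyR : ‖E4.spatial y‖ ≤ R := by
    have : K.radius x ≤ R := hxr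
    simpa [hK, boostedKerrBackground, hPI, hyr] using this
  have hyRp : ‖E4.spatial y‖ ≤ Rp := hyR.trans (le_max_left _ _)
  have hrpy : Kerr.rPlus (M i) 0 < ‖E4.spatial y‖ := by
    have h := (mem_boostedKerrExterior.mp hxΩ)
    rw [Kerr.mem_exterior, max_eq_left hrp.le, hPI, hyr] at h
    exact h
  have hypos : 0 < ‖E4.spatial y‖ := hrp.trans hrpy
  have hx0 : x 0 = Lorentz.gamma V * (y 0 + inner ℝ V (E4.spatial y)) := by
    have : x = Lorentz.boostCLM V y := by
      rw [hy, ← Lorentz.coe_boost_apply hV, ContinuousLinearEquiv.apply_symm_apply]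
    rw [this, Lorentz.boostCLM_apply_zero]
  have hγ1 := Lorentz.one_le_gamma hV
  have hinner : -Rp ≤ inner ℝ V (E4.spatial y) := by
    have h1 := abs_real_inner_le_norm V (E4.spatial y)
    have h2 : ‖V‖ * ‖E4.spatial y‖ ≤ 1 * Rp := mul_le_mul hV.le hyRp (norm_nonneg _) zero_le_one
    have h3 := neg_abs_le (inner ℝ V (E4.spatial y))
    linarith
  have hwW : W₀ ≤ x 0 := by
    have hs : max W₀ 0 + 1 ≤ y 0 + inner ℝ V (E4.spatial y) := by rw [hy0]; linarith
    have hs0 : 0 ≤ y 0 + inner ℝ V (E4.spatial y) := by linarith [le_max_right W₀ 0]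
    have : y 0 + inner ℝ V (E4.spatial y) ≤ Lorentz.gamma V * (y 0 + inner ℝ V (E4.spatial y)) :=
      le_mul_of_one_le_left hs0 hγ1
    linarith [le_max_left W₀ 0]
  obtain ⟨hk, hoth, hdevw, hT1w, hρw⟩ := hW₀ (x 0) hwW
  obtain ⟨hk1, hk2, hk3, hk4, hk5, hk6, hk7⟩ := hk
  -- the honest zone is a neighbourhood of `x`
  have hAeq : A =ᶠ[𝓝 x] Ah := by
    have hSo : IsOpen {p : E4 | T₁ + 1 < p 0 ∧ ‖E4.spatial (Λe.symm p)‖ < ρ (p 0) / 2} := by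
      have h0 : Continuous fun p : E4 ↦ p 0 := (EuclideanSpace.proj (0 : Fin 4) : E4 →L[ℝ] ℝ).continuous
      have h1 : Continuous fun p : E4 ↦ ‖E4.spatial (Λe.symm p)‖ :=
        (E4.spatial.continuous.comp Λe.symm.continuous).norm
      exact (isOpen_lt continuous_const h0).inter
        (isOpen_lt h1 ((hρc.comp h0).div_const 2))
    have hxS : x ∈ {p : E4 | T₁ + 1 < p 0 ∧ ‖E4.spatial (Λe.symm p)‖ < ρ (p 0) / 2} :=
      ⟨hT1w, by rw [← hy]; linarith⟩
    exact Filter.eventuallyEq_of_mem (hSo.mem_nhds hxS) fun p hp ↦ hAhon p hp.1.le hp.2.le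
  have hAx : A x = Ah x := hAeq.eq_of_nhds
  have hA0 : Ah x 0 = x 0 := by rw [hAh x, E4.ofTimeSpace_apply_zero]
  have hAxU : Ah x ∈ U := hAx ▸ hAU x hxΩ
  -- lab distance of `Ah x` from the painted centre of hole `i`
  have hdisti : ‖E4.spatial (Ah x) - ξ i (x 0)‖ ≤ Rp := by
    rw [hAh x, E4.spatial_ofTimeSpace, add_sub_cancel_left, restOffsetCLM_apply]
    exact (norm_restOffset_le (hv1 i (x 0)) _).trans hyRp
  have hoth' : ∀ j ≠ i, 0 < E4.spatialNorm (Lorentz.boostCLM (-v j (Ah x 0))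
      (Ah x - E4.ofTimeSpace (Ah x 0) (ξ j (Ah x 0)))) ∧
      ∀ l ≤ 2, ‖iteratedFDeriv ℝ l (H j) (Ah x)‖ ≤ η₂ := by
    intro j hj
    rw [hA0]
    exact hoth j hj (Ah x) hA0 hdisti
  -- the lab deviation at `Ah x`
  have hdevb : ∀ l ≤ 2, ‖iteratedFDeriv ℝ l (𝓢.deviationExtend Bf Φ) (Ah x)‖ ≤ η₁ := by
    intro l hl
    have hmem : Ah x ∈ Subtype.val '' Bf.timeSlab (x 0) := ⟨⟨Ah x, hAxU⟩, hA0, rfl⟩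
    have h1 := (enorm_iteratedFDeriv_le_supCkENorm hl hmem (𝓢.deviationExtend Bf Φ)).trans hdevw
    rw [← ofReal_norm] at h1
    exact (ENNReal.ofReal_le_ofReal_iff hη₁0.le).1 h1
  have key := norm_iteratedFDeriv_deviation_holeChart_le 𝓢 i M ξ v hv1 hV hAh hH hBb hξ hv U Φ hΦ
    hAc hAU hψ hxΩ hAeq hrp hCa0 hη₁0.le hη₂0.le hCKe (by rw [← hy]; exact hrpy.le)
    (by rw [← hy]; exact hyRp) hδ₀0.le hδ1 hk1 hk2 hk3 hk4 hk5 hk6 hk7 hoth' hAxU hdevb m hm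
  refine enorm_le_ofReal_of_norm_le (key.trans ?_)
  have : (16 : ℝ) * CKe * (2 * ‖Λi‖ + 5 + Ca) * (4 + Ca) * ((4 + Rp + 3 * ‖Λi‖) * δ₀) = Cδ * δ₀ := by
    rw [hCδ]; ring
  rw [this]
  exact hsum3

/-! ### Registered form -/

-- long chain of filters and `C²` bookkeeping (statement elaboration)
set_option maxHeartbeats 800000 in
/-- Registered sub-goal form (stub `tendsto_truncDeviationCk_holeChart` of the crux item) of
`tendsto_truncDeviationCk_holeChart'`. [folklore] -/
theorem tendsto_truncDeviationCk_holeChart : open Literature.Geometry.Lorentzian Filter Topology in ∀ (𝓢 : Spacetime 4) {N : ℕ} (i : Fin N) (M : Fin N → ℝ) (ξ v : Fin N → ℝ → E3) (hv1 : ∀ j t, ‖v j t‖ < 1) {V : E3} (hV : ‖V‖ < 1) {Ah : E4 → E4}, (∀ y : E4, Ah y = E4.ofTimeSpace (y 0) (ξ i (y 0) + (ContinuousLinearMap.id ℝ E3 - (Lorentz.gamma (v i (y 0)) / (Lorentz.gamma (v i (y 0)) + 1)) • (innerSL ℝ (v i (y 0))).smulRight (v i (y 0))) (E4.spatial ((Lorentz.boost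 V hV : E4 ≃L[ℝ] E4).symm y)))) → ∀ {H : Fin N → E4 → E4 →L[ℝ] E4 →L[ℝ] ℝ}, (∀ j z, H j z = boostedKerrBilin (Lorentz.boost (v j (z 0)) (hv1 j (z 0))) (E4.ofTimeSpace (z 0) (ξ j (z 0))) (M j) 0 z - Minkowski.bilin) → ∀ {Bb : E4 → E4 →L[ℝ] E4 →L[ℝ] ℝ}, (∀ z, Bb z = Minkowski.bilin + ∑ j, H j z) → (∀ j, ContDiff ℝ ((⊤ : ℕ∞) : WithTop ℕ∞) (ξ j)) → (∀ j, ContDiff ℝ ((⊤ : ℕ∞) : WithTop ℕ∞) (v j)) → ∀ (U : Opens E4) (Φ : U → 𝓢.carrier), ContMDiff 𝓘(ℝ, E4) (𝓡 4) ((⊤ : ℕ∞) : WithTop ℕ∞) Φ → ∀ {A : E4 → E4}, ContDiff ℝ ((⊤ : ℕ∞) : WithTop ℕ∞) A → ∀ (hAU : ∀ y ∈ boostedKerrExterior (Lorentz.boost V hV) 0 (M i) 0, A y ∈ U) {ψ : boostedKerrExterior (Lorentz.boost V hV) 0 (M i) 0 → 𝓢.carrier}, (∀ y, ψ y = Φ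 ⟨A y.1, hAU y.1 y.2⟩) → ∀ (Λ : Fin N → ℝ → lorentzGroup), (∀ j t, 0 < (((Λ j t : E4 ≃L[ℝ] E4) (E4.basisVector 0)) 0)) → (∀ j t, E4.spatial ((Λ j t : E4 ≃L[ℝ] E4) (E4.basisVector 0)) = (((Λ j t : E4 ≃L[ℝ] E4) (E4.basisVector 0)) 0) • v j t) → Tendsto (fun t ↦ 𝓢.deviationCk ⟨U, fun x ↦ Minkowski.bilin + ∑ j, (boostedKerrBilin (Λ j (x 0)) (E4.ofTimeSpace (x 0) (ξ j (x 0))) (M j) 0 x - Minkowski.bilin), fun x ↦ x 0, E4.spatialNorm⟩ Φ 2 t) atTop (𝓝 0) → ∀ {κ₀ : ℝ}, κ₀ < 1 → (∀ j t, ‖v j t‖ ≤ κ₀) → ∀ {Γ T₀ : ℝ}, (∀ j t, T₀ ≤ t → ∀ l, 1 ≤ l → l ≤ 2 → ‖iteratedDeriv l (v j) t‖ ≤ Γ) → (∀ j t, T₀ ≤ t → ∀ l, 1 ≤ l → l ≤ 2 → ‖iteratedDeriv l (ξ j) t‖ ≤ Γ) → (∀ j ≠ i, Tendsto (fun t ↦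 ‖ξ i t - ξ j t‖) atTop atTop) → 0 < M i → Tendsto (v i) atTop (𝓝 V) → Tendsto (deriv (ξ i)) atTop (𝓝 V) → (∀ l, 2 ≤ l → l ≤ 3 → Tendsto (fun t ↦ iteratedDeriv l (ξ i) t) atTop (𝓝 0)) → (∀ l, 1 ≤ l → l ≤ 3 → Tendsto (fun t ↦ iteratedDeriv l (v i) t) atTop (𝓝 0)) → ∀ {ρ : ℝ → ℝ}, Tendsto ρ atTop atTop → Continuous ρ → ∀ {T₁ : ℝ}, (∀ x : E4, T₁ + 1 ≤ x 0 → ‖E4.spatial ((Lorentz.boost V hV : E4 ≃L[ℝ] E4).symm x)‖ ≤ ρ (x 0) / 2 → A x = Ah x) → ∀ R : ℝ, Tendsto (fun τ ↦ 𝓢.truncDeviationCk (boostedKerrBackground (Lorentz.boost V hV) 0 (M i) 0) ψ 2 R τ) atTop (𝓝 0) :=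
  fun 𝓢 _ i M ξ v hv1 _ hV _ hAh _ hH _ hBb hξ hv U Φ hΦ _ hAc hAU _ hψ Λ hfut hvΛ hdev _ hκ₀ hvs _ _ hvb hξb hsep hMi hvV hξV hξ0 hv0 _ hρ hρc _ hAhon R ↦
    tendsto_truncDeviationCk_holeChart' 𝓢 i M ξ v hv1 hV hAh hH hBb hξ hv U Φ hΦ hAc hAU hψ Λ hfut hvΛ hdev hκ₀ hvs hvb hξb
      hsep hMi hvV hξV hξ0 hv0 hρ hρc hAhon R

end PointBound

end Summit.FinalStateConjecture.FinalStateConjecture.Theorems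

end
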